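import Literature.MathematicalPhysics.QuantumFieldTheory.LatticeGaugeProofs
import HarnessLib

/-!
# Crux `NonSimplyConnectedLatticeGap` (stmt-QuantumFields-16405), route `ConvexGribovBody`, line `Sketch` —
# stub `stub_kernelOneFormSymmetry` (K2: the kernel 1-form symmetry of the covering theory)

For a homomorphism `π : H →* G` from a compact group `H`, a matrix representation `ρ` of `G`, a coupling
`β` and a link field `c : Edge d L → H` with values in `ker π`, the torus Wilson measure of the covering
model `(H, ρ ∘ π)` is invariant under link-wise LEFT multiplication `V ↦ c * V`:

`(c * ·)_* μ_{Λ,β}^{(H, ρ ∘ π)} = μ_{Λ,β}^{(H, ρ ∘ π)}`.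

Physics: in the covering description the `(G, ρ)` Wilson theory (e.g. `G = SO(3) = S³/{±1}`) is the
`(H, ρ ∘ π)` theory, and the latter has an extra exact symmetry, the electric centre (kernel) 1-form
symmetry — multiplication of the links by any `ker π`-valued link field (for `SO(3)`: any `{±1}`-valued
field). It is a gauge transformation only when `c` is a coboundary; its charged objects are the
't Hooft loops.

Proof: (1) `π` kills `c`, so `π` of a plaquette holonomy of `c * V` is `π` of the plaquette holonomy of
`V` (`kernelOneForm_map_plaquetteHolonomy_mul`), whence the Wilson action of `ρ ∘ π` — which only reads
`π` of the holonomies — is invariant (`kernelOneForm_wilsonAction_mul`); (2) the product of the Haar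
probability measures over the links is left invariant under the Pi group (Mathlib
`Measure.pi.isMulLeftInvariant`, `map_mul_left_eq_self`; `kernelOneForm_map_pi_haarProbability_mul`);
(3) a measurable equivalence preserving both the reference measure and the density preserves the
`withDensity` measure (tree `withDensity_map_of_measurableEquiv`), so the un-normalised Wilson weight is
invariant (`kernelOneForm_map_wilsonWeight_mul`), and the normalisation `Z⁻¹` is a constant
(`Measure.map_smul`).
-/

set_option autoImplicit false

noncomputable section

open MeasureTheory

namespace Summit.QuantumFields.YangMills.Theorems.NonSimplyConnectedLatticeGap

open Literature.MathematicalPhysics.QuantumFieldTheory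

/-- **`π` of a plaquette holonomy is blind to a `ker π`-valued link field.** For `c` with values in
`ker π`, `π (U_p (c * V)) = π (U_p (V))`: expand the holonomy, push `π` through products and inverses,
and use `π (c e) = 1`. [folklore] -/
theorem kernelOneForm_map_plaquetteHolonomy_mul {d L : ℕ} {G H : Type} [Group G] [Group H]
    (π : H →* G) (c V : GaugeConfig d L H) (hc : ∀ e, c e ∈ π.ker) (x : Site d L) (i j : Fin d) :
    π (plaquetteHolonomy (c * V) x i j) = π (plaquetteHolonomy V x i j) := by
  have h1 : ∀ e, π (c e) = 1 := fun e => MonoidHom.mem_ker.mp (hc e)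
  simp only [plaquetteHolonomy, Pi.mul_apply, map_mul, map_inv, h1, one_mul]

/-- **The Wilson action of the covering model is invariant under the kernel 1-form symmetry.**
For `c` with values in `ker π`, `S_{ρ ∘ π}(c * V) = S_{ρ ∘ π}(V)`: the action only reads
`ρ (π (U_p))`, and `π (U_p (c * V)) = π (U_p V)` (`kernelOneForm_map_plaquetteHolonomy_mul`). [folklore] -/
theorem kernelOneForm_wilsonAction_mul {d L N : ℕ} [NeZero L] {G H : Type} [Group G] [Group H]
    (π : H →* G) (ρ : G →* Matrix (Fin N) (Fin N) ℂ) (c : GaugeConfig d L H)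
    (hc : ∀ e, c e ∈ π.ker) (V : GaugeConfig d L H) :
    wilsonAction (ρ.comp π) (c * V) = wilsonAction (ρ.comp π) V := by
  simp only [wilsonAction, MonoidHom.comp_apply, kernelOneForm_map_plaquetteHolonomy_mul π c V hc]

/-- **Left invariance of the product Haar measure over the links.** The product over the torus links
of the Haar probability measures of the compact group `H` is invariant under left multiplication by
any link field `c` in the Pi group `H^E` (Mathlib `Measure.pi.isMulLeftInvariant`). [folklore] -/
theorem kernelOneForm_map_pi_haarProbability_mul {d L : ℕ} [NeZero L] {H : Type} [Group H] [TopologicalSpace H]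
    [IsTopologicalGroup H] [CompactSpace H] [MeasurableSpace H] [BorelSpace H]
    (c : GaugeConfig d L H) :
    (Measure.pi fun _ : Edge d L => haarProbability H).map (fun V => c * V) =
      Measure.pi fun _ : Edge d L => haarProbability H :=
  map_mul_left_eq_self _ c

/-- **The un-normalised Wilson weight of the covering model is invariant under the kernel 1-form
symmetry.** For `c` with values in `ker π`, `(c * ·)_* (e^{-β S_{ρ∘π}} dHaar^{⊗E}) = e^{-β S_{ρ∘π}} dHaar^{⊗E}`:
left multiplication by `c` is a measurable equivalence of `H^E` (`MeasurableEquiv.mulLeft`) preserving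
the product Haar measure (`kernelOneForm_map_pi_haarProbability_mul`) and the density
(`kernelOneForm_wilsonAction_mul`), hence the `withDensity` measure
(`withDensity_map_of_measurableEquiv`). [folklore] -/
theorem kernelOneForm_map_wilsonWeight_mul {d L N : ℕ} [NeZero L] {G H : Type} [Group G] [Group H]
    [TopologicalSpace H] [IsTopologicalGroup H] [CompactSpace H] [MeasurableSpace H] [BorelSpace H]
    (π : H →* G) (ρ : G →* Matrix (Fin N) (Fin N) ℂ) (β : ℝ) (c : GaugeConfig d L H)
    (hc : ∀ e, c e ∈ π.ker) :
    (wilsonWeight (d := d) (L := L) (ρ.comp π) β).map (fun V => c * V) =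
      wilsonWeight (d := d) (L := L) (ρ.comp π) β :=
  withDensity_map_of_measurableEquiv (Measure.pi fun _ : Edge d L => haarProbability H)
    (MeasurableEquiv.mulLeft c) _ (kernelOneForm_map_pi_haarProbability_mul c) fun V => by
      simp only [MeasurableEquiv.coe_mulLeft, kernelOneForm_wilsonAction_mul π ρ c hc]

/-- **STUB K2 — the kernel 1-form symmetry of the covering theory.** For any homomorphism `π : H →* G`
from a compact group `H`, any representation `ρ` of `G` and any link field `c` with values in `ker π`,
the `(H, ρ ∘ π)` Wilson measure on the torus is invariant under link-wise left multiplication by `c`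
(the density factors through `π`, which kills `c`; the product Haar measure is left invariant; the
partition function is a constant factor). [folklore] -/
theorem stub_kernelOneFormSymmetry :
    ∀ (d L : ℕ) [NeZero L] (G H : Type) [Group G] [Group H] [TopologicalSpace H] [IsTopologicalGroup H]
      [CompactSpace H] [MeasurableSpace H] [BorelSpace H] (π : H →* G) (N : ℕ)
      (ρ : G →* Matrix (Fin N) (Fin N) ℂ) (β : ℝ)
      (c : Literature.MathematicalPhysics.QuantumFieldTheory.Edge d L → H), (∀ e, c e ∈ π.ker) →
      (Literature.MathematicalPhysics.QuantumFieldTheory.wilsonMeasure (d := d) (L := L) (ρ.comp π) β).map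
          (fun V => c * V) =
        Literature.MathematicalPhysics.QuantumFieldTheory.wilsonMeasure (d := d) (L := L) (ρ.comp π) β := by
  intro d L _ G H _ _ _ _ _ _ _ π N ρ β c hc
  rw [wilsonMeasure, Measure.map_smul, kernelOneForm_map_wilsonWeight_mul π ρ β c hc]

end Summit.QuantumFields.YangMills.Theorems.NonSimplyConnectedLatticeGap

end
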